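import Literature.NumberTheory.NumberFields.GassmannTwoActions
import HarnessLib

/-!
# Two actions with the same permutation character, degree `≤ 6`: the Klein-four case

Topic `NumberTheory/NumberFields`; theorem-only file (D-0026), third of four files on the group
theory of Perlis's Theorem 3 [Perlis1977, §4] (overview in `GassmannPermChar`, setting in
`GassmannTwoActions`).

* `sixStructure` — if `S ≤ Stab(x₀')` fixes no point of `X` then (`r = 3`) `#X = 6`, `S` is
  abelian of order `4` with two-point orbits on `X`, exactly two fixed points on `X'`, every
  `s ≠ 1` fixing exactly these, and `S` transitive on the remaining four points of `X'`
  (squares act trivially on `X`, so `S` is an elementary abelian `2`-group; the fixed points on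
  `X'` are even in number by the `p`-group fixed-point congruence and at most two by the orbit
  count);
* conjugation bookkeeping (`fixedPoints_stabilizer_smul`, `fixedBy_conj`, `card_stabilizer_eq`,
  `card_stabilizer_inf_eq`) and the double count `sum_card_fixedBy_eq_mul`:
  `Σ_{m ∈ N} #Fix(m) = #Y · #(Stab ∩ N)` for a normal subgroup `N`, whence `card_inf_eq`: equal
  permutation characters give `#(Stab(x₀) ∩ N) = #(Stab(x₀') ∩ N)` for every normal `N`.

## References

* [Perlis1977] R. Perlis, *On the equation `ζ_K(s) = ζ_{K'}(s)`*, J. Number Theory 9 (1977),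
  342–360: §1 Lemma 1 (Gassmann equivalence via coset types), §4 Theorems 2–3 (pp. 353–358).
* F. Gassmann, *Bemerkungen zu der vorstehenden Arbeit von Hurwitz*, Math. Z. 25 (1926), 124–143
  (cited through Perlis).
-/

noncomputable section

open MulAction Subgroup
open scoped Pointwise

namespace Literature.NumberTheory.NumberFields

namespace Gassmann

section TwoActions

variable {G : Type*} [Group G] {X X' : Type*} [MulAction G X] [MulAction G X']

variable [Finite G] [Finite X] [Finite X']

/-- **Case `r = 3` forces the Klein-four configuration**: for `S ≤ Stab(x₀')` fixing no point of
`X` (and `#X ≤ 6`), necessarily `#X = 6`, `S` is an abelian group of order `4` whose orbits on `X`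
all have two points, with exactly two fixed points on `X'`, every `s ≠ 1` fixing exactly these, and
acting transitively on the other four points of `X'`. [folklore] -/
theorem sixStructure (hc : Nat.card X = Nat.card X')
    (hf : ∀ g : G, (∀ x : X, g • x = x) → g = 1)
    (hf' : ∀ g : G, (∀ x' : X', g • x' = x') → g = 1)
    (hfix : ∀ g : G, Nat.card (fixedBy X g) = Nat.card (fixedBy X' g))
    (hn : Nat.card X ≤ 6) {S : Subgroup G} {x₀' : X'} (hS : S ≤ stabilizer G x₀')
    (hno : ∀ x : X, ∃ g ∈ S, g • x ≠ x) :
    Nat.card X = 6 ∧ Nat.card S = 4 ∧ (∀ a ∈ S, ∀ b ∈ S, a * b = b * a) ∧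
    (∀ x : X, (orbit S x).ncard = 2) ∧ (fixedPoints S X').ncard = 2 ∧
    (∀ g ∈ S, g ≠ 1 → fixedBy X' g = fixedPoints S X') ∧
    (∀ z ∉ fixedPoints S X', ∀ w ∉ fixedPoints S X', ∃ g ∈ S, g • z = w) := by
  classical
  obtain ⟨h2, h3, h2r, hbound⟩ := card_quotient_bounds hc hfix hn hS hno
  have hr : Nat.card (orbitRel.Quotient S X') = 3 := by
    rcases (by omega : Nat.card (orbitRel.Quotient S X') = 2 ∨
      Nat.card (orbitRel.Quotient S X') = 3) with h2' | h3'
    · exact (false_of_card_quotient_eq_two hc hf hfix hn hS hno h2').elim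
    · exact h3'
  rw [hr] at h2r hbound
  have hn6 : Nat.card X = 6 := by omega
  have hn6' : Nat.card X' = 6 := hc ▸ hn6
  have horb2 : ∀ x : X, (orbit S x).ncard = 2 := fun x =>
    le_antisymm (by have := hbound x; omega) (two_le_ncard_orbit hno x)
  -- squares are trivial, `S` is an elementary abelian `2`-group
  have hsq : ∀ s : S, s * s = 1 := by
    intro s
    apply Subtype.ext
    apply hf
    intro x
    show ((s * s : S) : G) • x = x
    rw [Subgroup.coe_mul, mul_smul]
    exact smul_smul_eq_of_ncard_orbit_eq_two s (horb2 x)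
  have hinv : ∀ s : S, s⁻¹ = s := fun s => (eq_inv_of_mul_eq_one_left (hsq s)).symm
  have hcommS : ∀ a b : S, a * b = b * a := by
    intro a b
    calc a * b = (a * b)⁻¹ := (hinv (a * b)).symm
      _ = b⁻¹ * a⁻¹ := mul_inv_rev a b
      _ = b * a := by rw [hinv, hinv]
  have hcomm : ∀ a ∈ S, ∀ b ∈ S, a * b = b * a := fun a ha b hb =>
    congrArg Subtype.val (hcommS ⟨a, ha⟩ ⟨b, hb⟩)
  have hP : IsPGroup 2 S := fun s => ⟨1, by rw [pow_one, pow_two]; exact hsq s⟩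
  -- the fixed points `T` of `S` on `X'`
  have hx₀'T : x₀' ∈ fixedPoints S X' := fun s => mem_stabilizer_iff.mp (hS s.2)
  have key : ∀ t ∈ fixedPoints S X', ∀ u : X',
      (Quotient.mk'' u : orbitRel.Quotient S X') = Quotient.mk'' t → u = t := by
    intro t ht u hu
    rw [mk_eq_mk_iff] at hu
    exact (mem_fixedPoints'.mp ht) u hu
  have hSne : ∃ s : S, s ≠ 1 := by
    haveI : Nonempty X := Finite.card_pos_iff.mp (by omega : 0 < Nat.card X)
    obtain ⟨x⟩ := (inferInstance : Nonempty X)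
    obtain ⟨g, hg, hgx⟩ := hno x
    refine ⟨⟨g, hg⟩, fun h1 => hgx ?_⟩
    have : g = 1 := congrArg Subtype.val h1
    rw [this, one_smul]
  have hTne : ∃ y : X', y ∉ fixedPoints S X' := by
    by_contra hall
    push Not at hall
    obtain ⟨s, hs1⟩ := hSne
    exact hs1 (Subtype.ext (hf' (s : G) fun y => hall y s))
  have hTle : (fixedPoints S X').ncard ≤ 2 := by
    by_contra hlt
    push Not at hlt
    obtain ⟨a, b, c, ha, hb, hc, hab, hac, hbc⟩ := (Set.two_lt_ncard_iff).mp hlt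
    obtain ⟨y, hy⟩ := hTne
    have h4 := four_le_card (α := orbitRel.Quotient S X') (a := Quotient.mk'' a)
      (b := Quotient.mk'' b) (c := Quotient.mk'' c) (d := Quotient.mk'' y)
      (fun e => hab (key b hb a e)) (fun e => hac (key c hc a e))
      (fun e => hy (by rw [key a ha y e.symm]; exact ha))
      (fun e => hbc (key c hc b e))
      (fun e => hy (by rw [key b hb y e.symm]; exact hb))
      (fun e => hy (by rw [key c hc y e.symm]; exact hc))
    omega
  have hTeven : (fixedPoints S X').ncard % 2 = 0 := by
    have hmod := hP.card_modEq_card_fixedPoints X'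
    rw [Nat.ModEq, hn6', Nat.card_coe_set_eq] at hmod
    omega
  have hTpos : 0 < (fixedPoints S X').ncard := (Set.ncard_pos).mpr ⟨x₀', hx₀'T⟩
  have hT2 : (fixedPoints S X').ncard = 2 := by omega
  -- the complement of `T` is a single orbit
  have hTorb : ∀ y ∉ fixedPoints S X', ∀ z ∉ fixedPoints S X', z ∈ orbit S y := by
    intro y hy z hz
    by_contra hzy
    obtain ⟨a, b, hab, hTab⟩ := Set.ncard_eq_two.mp hT2
    have ha : a ∈ fixedPoints S X' := by rw [hTab]; simp
    have hb : b ∈ fixedPoints S X' := by rw [hTab]; simp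
    have h4 := four_le_card (α := orbitRel.Quotient S X') (a := Quotient.mk'' a)
      (b := Quotient.mk'' b) (c := Quotient.mk'' y) (d := Quotient.mk'' z)
      (fun e => hab (key b hb a e))
      (fun e => hy (by rw [key a ha y e.symm]; exact ha))
      (fun e => hz (by rw [key a ha z e.symm]; exact ha))
      (fun e => hy (by rw [key b hb y e.symm]; exact hb))
      (fun e => hz (by rw [key b hb z e.symm]; exact hb))
      (fun e => hzy (mem_orbit_symm.mp (mk_eq_mk_iff.mp e)))
    omega
  have hTc : ∀ y ∉ fixedPoints S X', orbit S y = (fixedPoints S X')ᶜ := by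
    intro y hy
    ext z
    simp only [Set.mem_compl_iff]
    constructor
    · intro hz hzT
      apply hy
      have hyz : y ∈ orbit S z := mem_orbit_symm.mp hz
      rw [(mem_fixedPoints'.mp hzT) y hyz]
      exact hzT
    · exact hTorb y hy z
  have hTc4 : ((fixedPoints S X')ᶜ).ncard = 4 := by
    have hcc := Set.ncard_add_ncard_compl (fixedPoints S X')
    rw [hT2, hn6'] at hcc
    omega
  -- stabilizers of points outside `T` are trivial, so `#S = 4`
  have hstab : ∀ y ∉ fixedPoints S X', stabilizer S y = ⊥ := by
    intro y hy
    rw [eq_bot_iff]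
    intro u hu
    rw [Subgroup.mem_bot]
    apply Subtype.ext
    apply hf'
    intro z
    by_cases hz : z ∈ fixedPoints S X'
    · exact hz u
    · obtain ⟨s, rfl⟩ := hTorb y hy z hz
      show (u : G) • ((s : G) • y) = (s : G) • y
      rw [smul_smul, ← Subgroup.coe_mul, hcommS u s, Subgroup.coe_mul, mul_smul]
      exact congrArg ((s : G) • ·) (mem_stabilizer_iff.mp hu)
  obtain ⟨y₁, hy₁⟩ := hTne
  have hcard4 : Nat.card S = 4 := by
    have h1 := Subgroup.card_mul_index (stabilizer S y₁)
    rw [index_stabilizer, hTc y₁ hy₁, hTc4, hstab y₁ hy₁, Subgroup.card_bot, one_mul] at h1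
    exact h1.symm
  have hfixedBy : ∀ g ∈ S, g ≠ 1 → fixedBy X' g = fixedPoints S X' := by
    intro g hg hg1
    ext z
    rw [mem_fixedBy]
    constructor
    · intro hz
      by_contra hzT
      have hmem : (⟨g, hg⟩ : S) ∈ stabilizer S z := mem_stabilizer_iff.mpr hz
      rw [hstab z hzT, Subgroup.mem_bot] at hmem
      exact hg1 (congrArg Subtype.val hmem)
    · intro hz
      exact hz ⟨g, hg⟩
  exact ⟨hn6, hcard4, hcomm, horb2, hT2, hfixedBy,
    fun z hz w hw => by obtain ⟨s, hs⟩ := hTorb z hz w hw; exact ⟨s, s.2, hs⟩⟩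

/-! #### Conjugation bookkeeping -/

omit [Finite G] [Finite X] [Finite X'] in
/-- `Fix(G_{g•a}) = g • Fix(G_a)`. [folklore] -/
theorem fixedPoints_stabilizer_smul (g : G) (a : X) :
    fixedPoints (stabilizer G (g • a)) X = g • fixedPoints (stabilizer G a) X := by
  ext y
  rw [Set.mem_smul_set_iff_inv_smul_mem, mem_fixedPoints, mem_fixedPoints,
    stabilizer_smul_eq_stabilizer_map_conj]
  constructor
  · rintro hy ⟨v, hv⟩
    have hu : g * v * g⁻¹ ∈ (stabilizer G a).map (MulAut.conj g).toMonoidHom :=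
      Subgroup.mem_map.mpr ⟨v, hv, rfl⟩
    have e : (g * v * g⁻¹) • y = y := hy ⟨g * v * g⁻¹, hu⟩
    show v • g⁻¹ • y = g⁻¹ • y
    calc v • g⁻¹ • y = g⁻¹ • ((g * v * g⁻¹) • y) := by simp only [mul_smul, inv_smul_smul]
      _ = g⁻¹ • y := by rw [e]
  · rintro hy ⟨u, hu⟩
    obtain ⟨v, hv, rfl⟩ := Subgroup.mem_map.mp hu
    have e : v • g⁻¹ • y = g⁻¹ • y := hy ⟨v, hv⟩
    show (g * v * g⁻¹) • y = y
    calc (g * v * g⁻¹) • y = g • (v • g⁻¹ • y) := by simp only [mul_smul]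
      _ = y := by rw [e, smul_inv_smul]

omit [Finite G] [Finite X] [Finite X'] in
/-- `Fix(g v g⁻¹) = g • Fix(v)`. [folklore] -/
theorem fixedBy_conj (g v : G) : fixedBy X (g * v * g⁻¹) = g • fixedBy X v := by
  ext y
  rw [Set.mem_smul_set_iff_inv_smul_mem, mem_fixedBy, mem_fixedBy]
  constructor
  · intro e
    calc v • g⁻¹ • y = g⁻¹ • ((g * v * g⁻¹) • y) := by simp only [mul_smul, inv_smul_smul]
      _ = g⁻¹ • y := by rw [e]
  · intro e
    calc (g * v * g⁻¹) • y = g • (v • g⁻¹ • y) := by simp only [mul_smul]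
      _ = y := by rw [e, smul_inv_smul]

omit [Finite G] [Finite X] [Finite X'] in
/-- Stabilizers of points of a transitive action have the same order. [folklore] -/
theorem card_stabilizer_eq [IsPretransitive G X] (a b : X) :
    Nat.card (stabilizer G a) = Nat.card (stabilizer G b) := by
  obtain ⟨g, rfl⟩ := exists_smul_eq G a b
  exact Nat.card_congr (stabilizerEquivStabilizer (rfl : g • a = g • a)).toEquiv

omit [Finite G] [Finite X] [Finite X'] in
/-- For a normal subgroup `N`, the groups `G_a ∩ N` along a transitive action are conjugate, in
particular of the same order. [folklore] -/
theorem card_stabilizer_inf_eq [IsPretransitive G X] (N : Subgroup G) [hN : N.Normal] (a b : X) :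
    Nat.card ↥(stabilizer G a ⊓ N) = Nat.card ↥(stabilizer G b ⊓ N) := by
  obtain ⟨g, rfl⟩ := exists_smul_eq G a b
  symm
  refine Nat.card_congr
    { toFun := fun m => ⟨g⁻¹ * m * g, ?_⟩
      invFun := fun m => ⟨g * m * g⁻¹, ?_⟩
      left_inv := fun m => Subtype.ext (by simp [mul_assoc])
      right_inv := fun m => Subtype.ext (by simp [mul_assoc]) }
  · obtain ⟨h1, h2⟩ := Subgroup.mem_inf.mp m.2
    refine Subgroup.mem_inf.mpr ⟨?_, hN.conj_mem' _ h2 g⟩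
    rw [mem_stabilizer_iff] at h1 ⊢
    calc (g⁻¹ * m * g) • a = g⁻¹ • ((m : G) • g • a) := by simp only [mul_smul]
      _ = a := by rw [h1, inv_smul_smul]
  · obtain ⟨h1, h2⟩ := Subgroup.mem_inf.mp m.2
    refine Subgroup.mem_inf.mpr ⟨?_, hN.conj_mem _ h2 g⟩
    rw [mem_stabilizer_iff] at h1 ⊢
    calc (g * m * g⁻¹) • g • a = g • ((m : G) • a) := by simp only [mul_smul, inv_smul_smul]
      _ = g • a := by rw [h1]

omit [Finite G] [Finite X] [Finite X'] in
/-- `Σ_{m ∈ N} #Fix_Y(m) = #Y · #(G_{y₀} ∩ N)` for a normal subgroup `N` and a transitive action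
(double counting of `{(m, y) : m • y = y}`). [folklore] -/
theorem sum_card_fixedBy_eq_mul {Y : Type*} [MulAction G Y] [Finite Y] [IsPretransitive G Y]
    (N : Subgroup G) [N.Normal] [Fintype N] (y₀ : Y) :
    ∑ m : N, Nat.card (fixedBy Y (m : G)) = Nat.card Y * Nat.card ↥(stabilizer G y₀ ⊓ N) := by
  classical
  letI := Fintype.ofFinite Y
  calc ∑ m : N, Nat.card (fixedBy Y (m : G))
      = ∑ m : N, Nat.card {y : Y // (m : G) • y = y} := rfl
    _ = Nat.card (Σ m : N, {y : Y // (m : G) • y = y}) := Nat.card_sigma.symm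
    _ = Nat.card {c : N × Y // (c.1 : G) • c.2 = c.2} :=
        Nat.card_congr (Equiv.subtypeProdEquivSigmaSubtype fun (m : N) (y : Y) => (m : G) • y = y).symm
    _ = Nat.card {c : Y × N // (c.2 : G) • c.1 = c.1} :=
        Nat.card_congr (Equiv.subtypeEquiv (Equiv.prodComm N Y) fun c => Iff.rfl)
    _ = Nat.card (Σ y : Y, {m : N // (m : G) • y = y}) :=
        Nat.card_congr (Equiv.subtypeProdEquivSigmaSubtype fun (y : Y) (m : N) => (m : G) • y = y)
    _ = ∑ y : Y, Nat.card {m : N // (m : G) • y = y} := Nat.card_sigma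
    _ = ∑ y : Y, Nat.card ↥(stabilizer G y ⊓ N) := by
        refine Finset.sum_congr rfl fun y _ => Nat.card_congr ?_
        exact
          { toFun := fun m => ⟨(m.1 : G), Subgroup.mem_inf.mpr ⟨mem_stabilizer_iff.mpr m.2, m.1.2⟩⟩
            invFun := fun u => ⟨⟨u.1, (Subgroup.mem_inf.mp u.2).2⟩,
              mem_stabilizer_iff.mp (Subgroup.mem_inf.mp u.2).1⟩
            left_inv := fun m => rfl
            right_inv := fun u => rfl }
    _ = ∑ _y : Y, Nat.card ↥(stabilizer G y₀ ⊓ N) :=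
        Finset.sum_congr rfl fun y _ => card_stabilizer_inf_eq N y y₀
    _ = Nat.card Y * Nat.card ↥(stabilizer G y₀ ⊓ N) := by
        rw [Finset.sum_const, Finset.card_univ, smul_eq_mul, ← Nat.card_eq_fintype_card]

/-- Equal permutation characters give `#(G_{x₀} ∩ N) = #(G_{x₀'} ∩ N)` for every normal
subgroup `N` (sum the characters over `N`). [folklore] -/
theorem card_inf_eq [IsPretransitive G X] [IsPretransitive G X'] (hc : Nat.card X = Nat.card X')
    (hfix : ∀ g : G, Nat.card (fixedBy X g) = Nat.card (fixedBy X' g))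
    (N : Subgroup G) [N.Normal] (x₀ : X) (x₀' : X') :
    Nat.card ↥(stabilizer G x₀ ⊓ N) = Nat.card ↥(stabilizer G x₀' ⊓ N) := by
  classical
  letI := Fintype.ofFinite N
  have e1 := sum_card_fixedBy_eq_mul (Y := X) N x₀
  have e2 := sum_card_fixedBy_eq_mul (Y := X') N x₀'
  have e3 : ∑ m : N, Nat.card (fixedBy X (m : G)) = ∑ m : N, Nat.card (fixedBy X' (m : G)) :=
    Finset.sum_congr rfl fun m _ => hfix m
  rw [e1, e2, ← hc] at e3
  exact Nat.eq_of_mul_eq_mul_left (Finite.card_pos_iff.mpr ⟨x₀⟩) e3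

end TwoActions

end Gassmann

end Literature.NumberTheory.NumberFields
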